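import Summits.NavierStokesRegularity.NavierStokesRegularity.Theses.SymmetryModuliCount
import Summits.NavierStokesRegularity.NavierStokesRegularity.Theses.RecurrentProfiles
import Summits.NavierStokesRegularity.NavierStokesRegularity.Theses.DulacContraction
import Summits.NavierStokesRegularity.NavierStokesRegularity.Theorems.SymmetryModuliCountForcedSymmetryCollapse
import Summits.NavierStokesRegularity.NavierStokesRegularity.Theorems.RecurrentProfilesRecurrentReduction
import Summits.NavierStokesRegularity.NavierStokesRegularity.Theorems.SymmetryModuliCountForcedSymmetryBlowDownResidual
import Summits.NavierStokesRegularity.NavierStokesRegularity.Theorems.SymmetryModuliCountForcedSymmetrySingularBlowDownLimit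
import Summits.NavierStokesRegularity.NavierStokesRegularity.Theorems.SymmetryModuliCountForcedSymmetryStubPressureStructure
import Summits.NavierStokesRegularity.NavierStokesRegularity.Theorems.SymmetryModuliCountForcedSymmetryStubSliceOscillation
import Summits.NavierStokesRegularity.NavierStokesRegularity.Theorems.SymmetryModuliCountForcedSymmetryStubOscTimeIntegration
import Summits.NavierStokesRegularity.NavierStokesRegularity.Theorems.SymmetryModuliCountForcedSymmetryStubOscAllScales
import Summits.NavierStokesRegularity.NavierStokesRegularity.Theorems.SymmetryModuliCountForcedSymmetryStubSlabProfileOfBounds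
import Summits.NavierStokesRegularity.NavierStokesRegularity.Theorems.SymmetryModuliCountForcedSymmetryStubSlabProfileOfNonzero
import Summits.NavierStokesRegularity.NavierStokesRegularity.Theorems.SymmetryModuliCountForcedSymmetryStubRdssClauseCongrAe
import Summits.NavierStokesRegularity.NavierStokesRegularity.Theorems.SymmetryModuliCountForcedSymmetryRdssLiouvilleTauReduction
import Summits.NavierStokesRegularity.NavierStokesRegularity.Theorems.SymmetryModuliCountForcedSymmetryStubDecayOfSatelliteFree
import Summits.NavierStokesRegularity.NavierStokesRegularity.Theorems.SymmetryModuliCountForcedSymmetryStubBlowDownDriverStPull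
import Summits.NavierStokesRegularity.NavierStokesRegularity.Theorems.SqueezeCycleExtremalElementExistsRegularity
import Literature.Analysis.FluidPDE.TypeIRateOseenMildRepresentative
import Literature.Analysis.FluidPDE.TypeIAncientMild
import Literature.Analysis.FluidPDE.ClassicalSolution
import Literature.Analysis.FluidPDE.LocalTypeI
import Literature.Analysis.FluidPDE.SelfSimilar
import HarnessLib.Audit

/-!
# Skeleton line `recurrent-closing` for crux `ForcedSymmetry` (stmt-NavierStokesRegularity-4052) — strategist gen p1

Route `SymmetryModuliCount`, sub-problem `NavierStokesRegularity`.  Crux-strategist (wall-breaker) seat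
`planner-cstrat-stmt-NavierStokesRegularity-4052-p1-0`, 2026-08-17.  Line card: `Lines/recurrent-closing.md`;
census: `STRATEGY-CENSUS.md` (v2, §D5).

## Why a new line at all (the diagnosis this skeleton answers)

Every earlier line on this crux (`blow-down-census`, `far-past-energy-ledger`, `time-anchor-bootstrap`) died the same
death: its provable stubs landed and its ONE remaining stub was then kernel-checked EQUIVALENT to the route target
`X = TypeIAncientLiouville` (`forcedSymmetry_iff_typeIAncientLiouville`, `forcedSymmetry_iff_blowDownLimitSelfSimilar`,
p108644/p109874).  That death is structural for every skeleton of the shape "known-type stubs + one hard stub".  The only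
shape that cannot die that way is a FACTORISATION of `X` into (at least) two OPEN statements, each strictly weaker than
`X`, with DISJOINT refutation targets and disjoint toolkits.  This skeleton is the one such factorisation the tree's own
items already point at but no route has typed:

  `X`  ⇐  Bridge (known type)  ∘  RecurrentReduction (stmt-1590, PROVED, used BY NAME)
        ∘  RecurrentClosing (NEW: a uniformly scaling-recurrent singular Type-I profile is accompanied by a
           rotated-discretely-self-similar singular Type-I profile — the closing lemma of the scaling flow)
        ∘  RDSSLiouvilleInClass (= item stmt-8561 of route DulacContraction, VERBATIM BY NAME).

i.e. it factors the open crux `RecurrentProfiles.RecurrentLiouville` (stmt-1589) through `RDSSLiouvilleInClass`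
(stmt-8561): `RecurrentLiouville ⇐ RecurrentClosing ∧ RDSSLiouvilleInClass`.  Refutation targets are disjoint:
`RecurrentClosing` is false iff some Type-I scaling hull is aperiodic with NO (R)DSS profile anywhere in the class
(a quasi-periodic / weakly-mixing-without-periodic-points Type-I cascade), `RDSSLiouvilleInClass` is false iff a backward
(R)DSS Type-I profile exists (Bradshaw–Tsai OP 5.1 / Tsai 2018 Conj. 8.8–8.9 / Pineau–Vicol Conj. 1.1).  Toolkits are
disjoint: closing lemmas (Anosov–Katok, Lian–Young for C² semiflows on Hilbert space, Fiedler–Mallet-Paret's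
Poincaré–Bendixson for scalar parabolic PDE) versus self-similar Liouville theory (NRS/Tsai head pressure, Chae–Wolf
compactness at `λ ≈ 1`, Pineau–Vicol Thms 1.4/1.6/1.7, the landed `pineauVicol2026_rdss_liouville_holds`).

## Registered stubs (3)

* `stub_slabProfileOfNonzero` (BRIDGE, known type, M–L): a nonzero element of `A_C` (KNSS-mild, Type-I rate `C`)
  yields a local-energy profile on the slab `ℝ³ × (−∞,0)` — suitable weak with a global pressure, weak gradient,
  Albritton–Barker `𝐈 < ∞`, Type-I rate — that is SINGULAR at the space–time origin.  Inputs all landed: far-past ledger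
  (`FarPastLedger_proof`, stmt-14060), pressure package (`pressurePackage_of_ledger`), the blow-down driver and
  `exists_singular_limit_of_parts` (the limit `W ∈ A_C` is singular at `0`), mild ⇒ classical pair
  (`IsTypeIAncientMild.exists_isClassicalNSSolutionOn_Ioo`); what remains is packaging the global Oseen pressure
  `R_iR_j(W_iW_j)` into `IsSuitableWeakSolutionOn (slab …)` and bounding `typeIBound` on ALL cylinders of the slab by
  scale/translation invariance of the uniform constants `K(C)`, `D₀(C,K)`.
* `stub_recurrentClosing` (NEW, the hard stub): hypotheses VERBATIM those of `RecurrentProfiles.RecurrentLiouville`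
  (stmt-1589) plus `IsBackwardSingularPoint u 0`; conclusion: there EXISTS a smooth profile of the same kind (any rate
  constant) satisfying VERBATIM the six hypotheses of `DulacContraction.RDSSLiouvilleInClass` (stmt-8561) — including its
  `let act` RDSS clause — and singular at the origin.  (Orbit-closure form of the closing lemma; it does NOT claim the
  recurrent profile itself is RDSS, cf. DulacContraction's conditional K2 `SynchronizationForcesSelfSimilarity`.)
* `stub_rdssLiouville` : `DulacContraction.RDSSLiouvilleInClass` — item stmt-8561 BY NAME (shared; a proof of either
  closes both).

`ForcedSymmetry_of` composes them with the landed `recurrentReduction_proof` (stmt-1590) and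
`forcedSymmetry_of_typeIAncientLiouville` (collapse file) — pure logic, no `sorry`.

## Lead c3 reshape (gen 2→3, 2026-08-17): the bridge stub split into five registered sub-stubs — ALL LANDED

(gen 3: `stub_pressureStructure` p137885, `stub_sliceOscillation` p138269, `stub_oscTimeIntegration` p138261,
`stub_oscAllScales` p138164, `stub_slabProfileOfBounds` p138367 are now the landed Theorems, by name; the bridge
`stub_slabProfileOfNonzero` is sorry-free and LANDED p139433; gen 4 (below): the smoothness demand of stub 2 is
discharged — `stub_recurrentClosing` := `stub_recurrentClosingWeak` (closing lemma in the suitable-weak class, the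
research stub) + `classicalRepresentative_of_rdssProfile` (glue: `𝒦 ∋ w = v ∈ A_C` a.e. by KNSS L3.1/Prop 4.1,
`stub_rdssClause_congr_ae` p139220, `slabProfile_of_isTypeIAncientMild`); open stubs: `stub_recurrentClosingWeak`,
`stub_rdssLiouville` = stmt-8561.)

`stub_slabProfileOfNonzero` (bridge, M–L) is now a THEOREM of this skeleton, proved from five registered sub-stubs
plus landed tree theorems (far-past ledger `FarPastLedger_proof`, pressure package `pressurePackage_of_ledger`, cubic
bound `lintegral_parabolicCylinder_le`, singular blow-down limit `exists_singular_limit_of_parts`, far-shell sum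
`stub_fplFarShell`/`stub_fplCovering`):

* `stub_pressureStructure` — every `u ∈ A_C` has a GLOBAL classical pressure on `(−∞,0)` (glue the window pressures of
  `IsTypeIAncientMild.exists_isClassicalNSSolutionOn_Ioo`, normalised at `x = 0`, `ClassicalSolutionGlue`), and EVERY classical
  pressure of `u` on `(−∞,0)` has the KNSS near/far structure at unit scale at every `(τ, x₀)` (`nearFar_window` +
  `pressure_sub_apply_zero_eq_of_eventuallyEq`: two pressures of one velocity differ by a function of time);
* `stub_sliceOscillation` — pure slice estimate: the structure `q = c + p₁ + p₂` on `B(x₀,2)` with `‖p₁‖₂² ≤ A`,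
  `‖∇p₂‖ ≤ B` bounds `∫_{B(x₀,1)} |q − [q]_{B(x₀,1)}|^{3/2} ≤ c₁ (A^{3/4} + B^{3/2})`;
* `stub_oscTimeIntegration` — slice bounds `M₁(−τ)^{−3/4} + M₂` integrate to `D_osc(Q(z,1)) ≤ 4M₁ + M₂` for `z.1 ≤ 0`;
* `stub_oscAllScales` — a unit-scale bound for the whole class `A_C ∩ {ledger K}` (any classical pressure, any centre
  with `z.1 ≤ 0`) gives the same bound on every parabolic ball of the slab (zoom + backward shift invariance of the class,
  `cknDOsc_nsZoom`, `IsClassicalNSSolutionOn.nsRescale_translate`);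
* `stub_slabProfileOfBounds` — packaging: `u ∈ A_C` with ledger `K`, a classical pressure `p` on `(−∞,0)` and
  `D_osc ≤ D₁` on all balls is a suitable weak solution on the slab with weak gradient `∇u` and `𝐈 < ∞`
  (`isSuitableWeakSolutionOn_of_contDiffOn`, `C ≤ 2CK`, `A + E` from `Seregin2020.localEnergyBound_top`).

## Lead c5 reshape (gen 4→5, 2026-08-17): `stub_rdssLiouville` split along crux 8561's registered birth skeleton

Since gen 4, crux stmt-8561 (`DulacContraction.RDSSLiouvilleInClass`, = `stub_rdssLiouville` BY NAME) received its own
registered skeleton `Cruxes/RDSSLiouvilleInClass/Lines/birth.lean` (planner-skel, 2026-08-17): after the landed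
`τ`-reduction (`rdssLiouvilleInClass_iff_centreTimeZero`, p138494) the crux is LITERALLY "no satellites" ∧ "decay of a
satellite-free profile" ∧ "no singular centre".  Gen 5 adopts exactly those three stubs, signatures VERBATIM (so that a
landing serves both cruxes by name), and `stub_rdssLiouville` becomes a THEOREM of this skeleton (the birth composition
`rdssLiouvilleInClass_of_birth`, closed):

* `stub_satelliteExclusion` [L; OPEN LEMMA — gap (iii) of the printed rungs] — a `τ = 0` RDSS profile of the class is
  regular at every final-slice point `(0, y)` other than the spatial centre (`y ≠ l R y + ξ`).  Model: Chae–Wolf 2017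
  Thm 1.1 (`C_t Lᵖ`); not in print for `𝐈 < ∞` + time rate (held by the lead).
* `stub_decayOfSatelliteFree` [M; provable now, no Navier–Stokes input] — time rate + pointwise invariance + regular
  annulus ⇒ space–time decay `HasTypeIDecay C₀ w` (Chae–Wolf's scaling step).
* `stub_centredWall` [named OPEN PROBLEM: Bradshaw–Tsai 2017 OP 5.1 = Tsai 2018 Conj. 8.8–8.9 = Pineau–Vicol 2026
  Conj. 1.1, in the class] — an origin-centred RDSS profile of the class WITH space–time decay is regular at the origin;
  implied by the canonical `TypeIDSSLiouvilleConjecture` through the class bridge.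

Open stubs of gen 5 (4 ≤ stubs_max): `stub_recurrentClosingWeak` (c4 certificate p140852: ⇔ (8561 → X); promote-stub
filed), `stub_satelliteExclusion`, `stub_decayOfSatelliteFree`, `stub_centredWall`.

Gen 5.1 (lead c5, wave 1 integrated): `stub_decayOfSatelliteFree` LANDED (p142689) and is now a theorem of the skeleton;
`stub_centredWall` certified ⇐ `TypeIDSSLiouvilleConjecture` (p142593) with its near-identity rungs re-keyed to the class
(p142950, no decay needed); `stub_satelliteExclusion` tools (p142374) and the NEW near-identity satellite exclusion for pure
DSS about any centre (`satelliteExclusion_nearIdentity`, p142983).  Sorries left: 3 = `stub_recurrentClosingWeak`,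
`stub_satelliteExclusion`, `stub_centredWall`.

## Lead c6 (gen 5.2, 2026-08-17): `stub_satelliteExclusion` = ONE far-field number (Chae–Wolf Thm 1.1 inside the class)

No signature changed (same three sorries).  Landed `--supports` 4052 (sub-goal stubs registered): the in-class [gus] step
`not_isBackwardSingularPoint_of_tendsto_cknC` (p145479: slab class profile + `C(r;(0,x₀)) → 0` ⇒ regular; AB packaging +
Seregin–Šverák pressure decay + ESS ε-regularity over the class), Chae–Wolf's weighted Serrin estimate (2.5) for ROTATED
discrete self-similarity with ANY factor and ANY isometry (`lintegral_weighted_annulus_le_rdss`, p145574), and the criterion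
(`…StubSatelliteExclusionOfStripIntegrable`, p145769; `…StripCriterion`, p145870):
* `satelliteExclusion_of_stripIntegrable` — the stub's hypotheses VERBATIM + `∫∫_{(−l²,−1]×ℝ³} ‖w‖^p < ∞` for some
  `3 < p < 9` (equivalently, given the time rate, some `0 < p < 9`, e.g. finite ENERGY on one period strip) ⇒ the stub's
  conclusion VERBATIM, for every `l > 1`, every isometry `R`, every centre `ξ`;
* `satelliteExclusion_iff_stripIntegrable` — for centred profiles: satellite-free ⇔ `HasTypeIDecay` ⇔ strip-finite;
* `stub_satelliteExclusion_iff_stripIntegrability` — the registered stub ⇔ "every smooth RDSS profile of `𝒦_C` has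
  `∫∫_{(−l²,−1]×ℝ³} ‖w‖⁴ < ∞`".
So stub 3a is EXACTLY an `L⁴`-thinness statement for the far field of Type-I RDSS profiles on one period strip; it is not
implied by `𝐈 < ∞` + the time rate (the ledger saturates at `1/|x|` tails; a singular satellite orbit is log-sparse, invisible
to CKN/ledger counting).  Disprover target: an RDSS Type-I profile with a singular satellite orbit ⇔ infinite `L⁴` on a strip.

## Disproof used

`Cruxes/ForcedSymmetry/Disproof.lean` v9: `forcedSymmetry_false_without_H3` / `not_forcedSymmetryOnDriftClass` honoured —
every stub quantifies over genuine Navier–Stokes classes (`IsTypeIAncientMild`; suitable weak + `typeIBound < ⊤`, which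
kills the parasitic drifts), never over the kinematic Type-I class; §10 (`dss_does_not_force_symmetry`,
`ud_not_hasSimSymmetry8`: DSS does not yield the crux's `∃ξ` kinematically) is exactly why the DSS stratum is sent to a
LIOUVILLE stub (8561) and not to a symmetry; §5 (`C ≤ ε` empty corner) — the contradiction branch is entered only for a
nonzero element; §9(iv) (Choptuik: DSS without CSS) is consistent with the line (DSS is killed by 8561, not assumed
absent).  Negatives index (4 entries, 2026-08-17): none is an instance of a stub.
-/

noncomputable section

set_option linter.dupNamespace false

open MeasureTheory Set Filter Topology

namespace Summit.NavierStokesRegularity.NavierStokesRegularity.Cruxes.ForcedSymmetry.RecurrentClosing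

/-! ## The registered stubs -/

open Literature.Analysis.FluidPDE Metric

/-! ### Stub 1 (bridge) — its five sub-stubs are LANDED Theorems (see the bridge file's imports):
`stub_pressureStructure` p137885 · `stub_sliceOscillation` p138269 · `stub_oscTimeIntegration` p138261 ·
`stub_oscAllScales` p138164 · `stub_slabProfileOfBounds` p138367 (namespace `…Theorems.SymmetryModuliCountForcedSymmetry`). -/

/-! ### Stub 1 (bridge) — LANDED (p139433) -/

/-- **Stub 1 — BRIDGE**, now the landed theorem
`Theorems.SymmetryModuliCountForcedSymmetry.stub_slabProfileOfNonzero` (p139433): a nonzero element of `A_C` yields a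
slab profile of Albritton–Barker's local Type-I class, singular at the origin.
[cite: AlbrittonBarker2019, Def. 2.1, Lemma 2.2, Prop. 2.3 and §3; KochNadirashviliSereginSverak2009, §3–4] -/
theorem stub_slabProfileOfNonzero :
    ∀ (C : ℝ) (u : ℝ → EuclideanSpace ℝ (Fin 3) → EuclideanSpace ℝ (Fin 3)),
      Literature.Analysis.FluidPDE.IsTypeIAncientMild C u →
      (∃ t : ℝ, t < 0 ∧ ∃ x : EuclideanSpace ℝ (Fin 3), u t x ≠ 0) →
      ∃ (w : ℝ → EuclideanSpace ℝ (Fin 3) → EuclideanSpace ℝ (Fin 3)) (q : ℝ → EuclideanSpace ℝ (Fin 3) → ℝ)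
        (G : ℝ → EuclideanSpace ℝ (Fin 3) → EuclideanSpace ℝ (Fin 3) →L[ℝ] EuclideanSpace ℝ (Fin 3)) (C' : ℝ),
        Literature.Analysis.FluidPDE.IsSuitableWeakSolutionOn
            (Literature.Analysis.FluidPDE.slab (EuclideanSpace ℝ (Fin 3)) (Set.Iio 0) isOpen_Iio) 1 0 w q ∧
        Literature.Analysis.FluidPDE.HasWeakSpatialGradientOn
            (Literature.Analysis.FluidPDE.slab (EuclideanSpace ℝ (Fin 3)) (Set.Iio 0) isOpen_Iio) w G ∧
        Literature.Analysis.FluidPDE.typeIBound (Set.Iio (0 : ℝ) ×ˢ Set.univ) w q G < ⊤ ∧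
        Literature.Analysis.FluidPDE.HasTypeITimeDecay C' w ∧
        Literature.Analysis.FluidPDE.IsBackwardSingularPoint w 0 :=
  Summit.NavierStokesRegularity.NavierStokesRegularity.Theorems.SymmetryModuliCountForcedSymmetry.stub_slabProfileOfNonzero

/-! ### Stub 2 (recurrent closing) — gen 4 reshape: the research stub in the suitable-weak class + a provable upgrade -/

/-- **Stub 2′ — RECURRENT CLOSING in the suitable-weak class (the research stub; gen 4).**  Hypotheses VERBATIM those
of `RecurrentProfiles.RecurrentLiouville` (stmt-1589) plus `IsBackwardSingularPoint u 0`; conclusion: some profile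
`(w, q, H)` of the SAME class (suitable weak on the slab, weak gradient, `𝐈 < ∞`, Type-I rate `C'`) which is invariant a.e.
under one similarity `l • R⁻¹ w (l² t + τ) (l • R x + ξ)`, `l > 1`, `τ ≤ 0`, and singular at the origin.  Compared with
the gen-1 `stub_recurrentClosing` the demand `IsClassicalNSSolutionOn (Iio 0) 1 0 w q` is DROPPED: it is supplied by
`classicalRepresentative_of_rdssProfile` below (every profile of the class is a.e. an element of `A_C`, which is classical
with a pressure keeping it in the class).  This is the closing lemma of the scaling flow on Albritton–Barker's class in
orbit-closure form: periodic (mod `O(3)`) orbits accompany recurrent ones.  Why plausible / why it might fail: see the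
gen-1 docstring (Katok–Lian–Young closing for hyperbolic hull measures; residue = zero-entropy aperiodic hulls).
[KatokHasselblatt1995 §S.5; LianYoung2012; FiedlerMalletParet1989; BradshawTsai2017CPDE OP 5.1; PineauVicol2026] -/
theorem stub_recurrentClosingWeak :
    ∀ (u : ℝ → EuclideanSpace ℝ (Fin 3) → EuclideanSpace ℝ (Fin 3)) (p : ℝ → EuclideanSpace ℝ (Fin 3) → ℝ)
      (G : ℝ → EuclideanSpace ℝ (Fin 3) → EuclideanSpace ℝ (Fin 3) →L[ℝ] EuclideanSpace ℝ (Fin 3)) (C : ℝ),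
      IsSuitableWeakSolutionOn (slab (EuclideanSpace ℝ (Fin 3)) (Set.Iio 0) isOpen_Iio) 1 0 u p →
      HasWeakSpatialGradientOn (slab (EuclideanSpace ℝ (Fin 3)) (Set.Iio 0) isOpen_Iio) u G →
      typeIBound (Set.Iio (0 : ℝ) ×ˢ Set.univ) u p G < ⊤ →
      HasTypeITimeDecay C u →
      (∀ ε : ℝ, 0 < ε → ∀ K : Set (ℝ × EuclideanSpace ℝ (Fin 3)), IsCompact K → K ⊆ Set.Iic (0 : ℝ) ×ˢ Set.univ →
        ∃ L : ℝ, 0 < L ∧ ∀ a : ℝ, ∃ σ ∈ Set.Icc a (a + L),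
          eLpNorm (fun z : ℝ × EuclideanSpace ℝ (Fin 3) => nsRescale (Real.exp σ) u z.1 z.2 - u z.1 z.2) 3
            (volume.restrict K) ≤ ENNReal.ofReal ε) →
      IsBackwardSingularPoint u 0 →
      ∃ (w : ℝ → EuclideanSpace ℝ (Fin 3) → EuclideanSpace ℝ (Fin 3)) (q : ℝ → EuclideanSpace ℝ (Fin 3) → ℝ)
        (H : ℝ → EuclideanSpace ℝ (Fin 3) → EuclideanSpace ℝ (Fin 3) →L[ℝ] EuclideanSpace ℝ (Fin 3)) (C' : ℝ),
        IsSuitableWeakSolutionOn (slab (EuclideanSpace ℝ (Fin 3)) (Set.Iio 0) isOpen_Iio) 1 0 w q ∧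
        HasWeakSpatialGradientOn (slab (EuclideanSpace ℝ (Fin 3)) (Set.Iio 0) isOpen_Iio) w H ∧
        typeIBound (Set.Iio (0 : ℝ) ×ˢ Set.univ) w q H < ⊤ ∧
        HasTypeITimeDecay C' w ∧
        (∃ l : ℝ, 1 < l ∧ ∃ (R : EuclideanSpace ℝ (Fin 3) ≃ₗᵢ[ℝ] EuclideanSpace ℝ (Fin 3))
            (ξ : EuclideanSpace ℝ (Fin 3)) (τ : ℝ), τ ≤ 0 ∧
            (fun z : ℝ × EuclideanSpace ℝ (Fin 3) => l • R.symm (w (l ^ 2 * z.1 + τ) (l • R z.2 + ξ)))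
              =ᵐ[volume.restrict (Set.Iio (0 : ℝ) ×ˢ Set.univ)]
            (fun z : ℝ × EuclideanSpace ℝ (Fin 3) => w z.1 z.2)) ∧
        IsBackwardSingularPoint w 0 := by
  sorry

/-- **The classical representative of an RDSS singular profile** (gen 4 glue, proved): a profile of Albritton–Barker's
class (suitable weak on the slab, `𝐈 < ∞`, Type-I rate `C'`) which is RDSS-invariant a.e. and singular at the origin may
be replaced by one that is, in addition, CLASSICAL on `(−∞,0)`: its continuous Oseen-mild representative `v ∈ A_{C'}`
(`exists_oseenMild_repr_of_typeIBound_lt_top` + `isTypeIAncientMild_of_continuous_oseenMild`, KNSS Lemma 3.1 / Prop 4.1)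
carries a classical pressure keeping it in the class (`slabProfile_of_isTypeIAncientMild`, the bridge file), the RDSS
clause transfers along the a.e. equality (`stub_rdssClause_congr_ae`, p139220) and so does the singular origin
(`isBackwardSingularPoint_zero_of_ae_eq`). [cite: KochNadirashviliSereginSverak2009, Lemma 3.1, Prop. 4.1; AlbrittonBarker2019, §3] -/
theorem classicalRepresentative_of_rdssProfile
    {w : ℝ → EuclideanSpace ℝ (Fin 3) → EuclideanSpace ℝ (Fin 3)} {q : ℝ → EuclideanSpace ℝ (Fin 3) → ℝ}
    {H : ℝ → EuclideanSpace ℝ (Fin 3) → EuclideanSpace ℝ (Fin 3) →L[ℝ] EuclideanSpace ℝ (Fin 3)} {C' : ℝ}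
    (hsw : IsSuitableWeakSolutionOn (slab (EuclideanSpace ℝ (Fin 3)) (Set.Iio 0) isOpen_Iio) 1 0 w q)
    (hI : typeIBound (Set.Iio (0 : ℝ) ×ˢ Set.univ) w q H < ⊤) (hdec : HasTypeITimeDecay C' w)
    (hrdss : ∃ l : ℝ, 1 < l ∧ ∃ (R : EuclideanSpace ℝ (Fin 3) ≃ₗᵢ[ℝ] EuclideanSpace ℝ (Fin 3))
        (ξ : EuclideanSpace ℝ (Fin 3)) (τ : ℝ), τ ≤ 0 ∧
        (fun z : ℝ × EuclideanSpace ℝ (Fin 3) => l • R.symm (w (l ^ 2 * z.1 + τ) (l • R z.2 + ξ)))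
          =ᵐ[volume.restrict (Set.Iio (0 : ℝ) ×ˢ Set.univ)]
        (fun z : ℝ × EuclideanSpace ℝ (Fin 3) => w z.1 z.2))
    (hsing : IsBackwardSingularPoint w 0) :
    ∃ (w' : ℝ → EuclideanSpace ℝ (Fin 3) → EuclideanSpace ℝ (Fin 3)) (q' : ℝ → EuclideanSpace ℝ (Fin 3) → ℝ)
      (H' : ℝ → EuclideanSpace ℝ (Fin 3) → EuclideanSpace ℝ (Fin 3) →L[ℝ] EuclideanSpace ℝ (Fin 3)) (C'' : ℝ),
      IsSuitableWeakSolutionOn (slab (EuclideanSpace ℝ (Fin 3)) (Set.Iio 0) isOpen_Iio) 1 0 w' q' ∧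
      HasWeakSpatialGradientOn (slab (EuclideanSpace ℝ (Fin 3)) (Set.Iio 0) isOpen_Iio) w' H' ∧
      typeIBound (Set.Iio (0 : ℝ) ×ˢ Set.univ) w' q' H' < ⊤ ∧
      HasTypeITimeDecay C'' w' ∧
      IsClassicalNSSolutionOn (Set.Iio 0) 1 0 w' q' ∧
      (∃ l : ℝ, 1 < l ∧ ∃ (R : EuclideanSpace ℝ (Fin 3) ≃ₗᵢ[ℝ] EuclideanSpace ℝ (Fin 3))
          (ξ : EuclideanSpace ℝ (Fin 3)) (τ : ℝ), τ ≤ 0 ∧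
          (fun z : ℝ × EuclideanSpace ℝ (Fin 3) => l • R.symm (w' (l ^ 2 * z.1 + τ) (l • R z.2 + ξ)))
            =ᵐ[volume.restrict (Set.Iio (0 : ℝ) ×ˢ Set.univ)]
          (fun z : ℝ × EuclideanSpace ℝ (Fin 3) => w' z.1 z.2)) ∧
      IsBackwardSingularPoint w' 0 := by
  -- the continuous Oseen-mild representative `v ∈ A_{C'}`
  obtain ⟨v, hae, hvc, hvd, hvm, hvC⟩ := exists_oseenMild_repr_of_typeIBound_lt_top hsw hdec hI
  have hv : IsTypeIAncientMild C' v :=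
    Summit.NavierStokesRegularity.NavierStokesRegularity.Theorems.isTypeIAncientMild_of_continuous_oseenMild hvc hvd hvm hvC
  -- `v` is a classical slab profile of the class
  obtain ⟨p, hp, hswv, hwgv, hIv⟩ :=
    Summit.NavierStokesRegularity.NavierStokesRegularity.Theorems.SymmetryModuliCountForcedSymmetry.slabProfile_of_isTypeIAncientMild hv
  have hae' : Function.uncurry w =ᵐ[volume.restrict (Set.Iio (0 : ℝ) ×ˢ Set.univ)] Function.uncurry v := hae
  refine ⟨v, p, fun t x => fderiv ℝ (v t) x, C', hswv, hwgv, hIv, hv.hasTypeITimeDecay, hp, ?_, ?_⟩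
  · exact Summit.NavierStokesRegularity.NavierStokesRegularity.Theorems.SymmetryModuliCountForcedSymmetry.stub_rdssClause_congr_ae
      w v hae' hrdss
  · have hsub : parabolicCylinder 1 (0 : ℝ × EuclideanSpace ℝ (Fin 3)) ⊆
        Set.Iio (0 : ℝ) ×ˢ (Set.univ : Set (EuclideanSpace ℝ (Fin 3))) :=
      parabolicCylinder_origin_subset_slab 1
    exact Summit.NavierStokesRegularity.NavierStokesRegularity.Theorems.SymmetryModuliCountForcedSymmetry.isBackwardSingularPoint_zero_of_ae_eq
      one_pos hsing (ae_restrict_of_ae_restrict_of_subset hsub hae')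

/-- **Stub 2 (gen 1 form, now a THEOREM of Stub 2′ + the classical-representative glue) — RECURRENT CLOSING: a uniformly scaling-recurrent Type-I profile singular at the
origin is accompanied by a rotated-discretely-self-similar Type-I profile singular at the origin.**  Hypotheses: VERBATIM
the class and the Birkhoff recurrence clause of `RecurrentProfiles.RecurrentLiouville` (stmt-1589), plus
`IsBackwardSingularPoint u 0`.  Conclusion: some smooth profile `(w, q, H)` with rate `C'` satisfying VERBATIM the
hypotheses of `DulacContraction.RDSSLiouvilleInClass` (stmt-8561) — suitable weak on the slab, weak gradient, `𝐈 < ∞`,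
Type-I rate, classical on `(−∞,0)`, and invariant a.e. under one similarity `l • R⁻¹ w (l² t + τ) (l • R x + ξ)` with
`l > 1`, `τ ≤ 0` — which is again singular at the origin.  This is the CLOSING LEMMA of the scaling flow on the Type-I
class in orbit-closure form: periodic (mod `O(3)`) orbits accompany recurrent ones.  Why plausible: the hull of `u` is a
compact minimal set of the scaling flow with no rest point (NRS/Tsai); for hyperbolic hull measures Katok–Lian–Young
closing gives (R)DSS profiles accumulating on the hull (card `Cruxes/RecurrentLiouville/Ideas/pesin-closing-hyperbolic-hulls.md`);
positive-entropy ("chaotic") renormalisation dynamics carries periodic orbits; the honest residue is a zero-entropy,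
non-periodic hull (quasi-periodically self-similar blow-up).  Sibling theorems: Fiedler–Mallet-Paret (scalar parabolic PDE
on `S¹`: ω-limit sets are periodic orbits or equilibria), Anosov closing.  Why it might fail: an aperiodic Type-I hull with
no (R)DSS profile in the whole class — e.g. an invariant 2-torus of the Leray similarity flow with irrational rotation.
[KatokHasselblatt1995 §S.5; LianYoung2012; FiedlerMalletParet1989; BradshawTsai2017CPDE OP 5.1; PineauVicol2026] -/
theorem stub_recurrentClosing :
    ∀ (u : ℝ → EuclideanSpace ℝ (Fin 3) → EuclideanSpace ℝ (Fin 3)) (p : ℝ → EuclideanSpace ℝ (Fin 3) → ℝ)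
      (G : ℝ → EuclideanSpace ℝ (Fin 3) → EuclideanSpace ℝ (Fin 3) →L[ℝ] EuclideanSpace ℝ (Fin 3)) (C : ℝ),
      Literature.Analysis.FluidPDE.IsSuitableWeakSolutionOn
          (Literature.Analysis.FluidPDE.slab (EuclideanSpace ℝ (Fin 3)) (Set.Iio 0) isOpen_Iio) 1 0 u p →
      Literature.Analysis.FluidPDE.HasWeakSpatialGradientOn
          (Literature.Analysis.FluidPDE.slab (EuclideanSpace ℝ (Fin 3)) (Set.Iio 0) isOpen_Iio) u G →
      Literature.Analysis.FluidPDE.typeIBound (Set.Iio (0 : ℝ) ×ˢ Set.univ) u p G < ⊤ →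
      Literature.Analysis.FluidPDE.HasTypeITimeDecay C u →
      (∀ ε : ℝ, 0 < ε → ∀ K : Set (ℝ × EuclideanSpace ℝ (Fin 3)), IsCompact K → K ⊆ Set.Iic (0 : ℝ) ×ˢ Set.univ →
        ∃ L : ℝ, 0 < L ∧ ∀ a : ℝ, ∃ σ ∈ Set.Icc a (a + L),
          MeasureTheory.eLpNorm (fun z : ℝ × EuclideanSpace ℝ (Fin 3) =>
            Literature.Analysis.FluidPDE.nsRescale (Real.exp σ) u z.1 z.2 - u z.1 z.2) 3
            (MeasureTheory.volume.restrict K) ≤ ENNReal.ofReal ε) →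
      Literature.Analysis.FluidPDE.IsBackwardSingularPoint u 0 →
      ∃ (w : ℝ → EuclideanSpace ℝ (Fin 3) → EuclideanSpace ℝ (Fin 3)) (q : ℝ → EuclideanSpace ℝ (Fin 3) → ℝ)
        (H : ℝ → EuclideanSpace ℝ (Fin 3) → EuclideanSpace ℝ (Fin 3) →L[ℝ] EuclideanSpace ℝ (Fin 3)) (C' : ℝ),
        Literature.Analysis.FluidPDE.IsSuitableWeakSolutionOn
            (Literature.Analysis.FluidPDE.slab (EuclideanSpace ℝ (Fin 3)) (Set.Iio 0) isOpen_Iio) 1 0 w q ∧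
        Literature.Analysis.FluidPDE.HasWeakSpatialGradientOn
            (Literature.Analysis.FluidPDE.slab (EuclideanSpace ℝ (Fin 3)) (Set.Iio 0) isOpen_Iio) w H ∧
        Literature.Analysis.FluidPDE.typeIBound (Set.Iio (0 : ℝ) ×ˢ Set.univ) w q H < ⊤ ∧
        Literature.Analysis.FluidPDE.HasTypeITimeDecay C' w ∧
        Literature.Analysis.FluidPDE.IsClassicalNSSolutionOn (Set.Iio 0) 1 0 w q ∧
        (∃ l : ℝ, 1 < l ∧ ∃ (R : EuclideanSpace ℝ (Fin 3) ≃ₗᵢ[ℝ] EuclideanSpace ℝ (Fin 3))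
            (ξ : EuclideanSpace ℝ (Fin 3)) (τ : ℝ), τ ≤ 0 ∧
            (fun z : ℝ × EuclideanSpace ℝ (Fin 3) => l • R.symm (w (l ^ 2 * z.1 + τ) (l • R z.2 + ξ)))
              =ᵐ[MeasureTheory.volume.restrict (Set.Iio (0 : ℝ) ×ˢ Set.univ)]
            (fun z : ℝ × EuclideanSpace ℝ (Fin 3) => w z.1 z.2)) ∧
        Literature.Analysis.FluidPDE.IsBackwardSingularPoint w 0 := by
  intro u p G C hsw hwg hI hdec hrec hsing
  obtain ⟨w, q, H, C', hw, hH, hIw, hCw, hrdss, hsingw⟩ := stub_recurrentClosingWeak u p G C hsw hwg hI hdec hrec hsing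
  obtain ⟨w', q', H', C'', h1, h2, h3, h4, h5, h6, h7⟩ := classicalRepresentative_of_rdssProfile hw hIw hCw hrdss hsingw
  exact ⟨w', q', H', C'', h1, h2, h3, h4, h5, h6, h7⟩

/-! ### Stub 3 (RDSS Liouville in the class = stmt-8561) — gen 5 reshape: the three birth stubs of crux 8561, VERBATIM -/

local notation "ℝ³" => EuclideanSpace ℝ (Fin 3)

/-- **stub 3a — `stub_satelliteExclusion` (L; OPEN LEMMA, gap (iii) of the printed rungs; registered stub of crux
stmt-8561's line `birth`, verbatim).** For every smooth profile `(w, q, H)` of `𝒦_C` (suitable weak on the slab, weak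
gradient, `𝐈 < ∞`, time rate `C`, classical on `(−∞,0)`) invariant a.e. on the slab under
`(t,x) ↦ l • R⁻¹ w (l²t) (l R x + ξ)`, `l > 1` (centre on the final slice), every point `(0, y)` with `y ≠ l R y + ξ` —
i.e. every final-slice point other than the spatial centre `x*` — is NOT a backward singular point.  Model: Chae–Wolf
2017 Thm 1.1 (arXiv:1610.09464; `C_t Lᵖ`, `3 ≤ p < ∞`).  Why it might fail: a Type-I RDSS profile with a singular
satellite orbit `x* + (lR)^{-k}(y − x*)` on its final slice — not excluded by CKN for a discrete factor (the orbit is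
`𝓗¹`-null) nor by `𝐈 < ∞` (bounds, not smallness). [c6, gen 5.2: ⇔ `∫∫_{(−l²,−1]×ℝ³} ‖w‖⁴ < ∞` for all such profiles — `stub_satelliteExclusion_iff_stripIntegrability`
(Theorems/…StubSatelliteExclusionStripCriterion); PROVED from finite `L^p` on one period strip, any `0 < p < 9`, any `l`, `R`, `ξ` —
`satelliteExclusion_of_stripIntegrable(_of_pos)`.]
[cite: ChaeWolf2017RemovingDSS, Thm 1.1; AlbrittonBarker2019, §1] -/
theorem stub_satelliteExclusion :
    ∀ (w : ℝ → ℝ³ → ℝ³) (q : ℝ → ℝ³ → ℝ) (H : ℝ → ℝ³ → ℝ³ →L[ℝ] ℝ³) (C : ℝ),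
      IsSuitableWeakSolutionOn (slab ℝ³ (Set.Iio 0) isOpen_Iio) 1 0 w q →
      HasWeakSpatialGradientOn (slab ℝ³ (Set.Iio 0) isOpen_Iio) w H →
      typeIBound (Set.Iio (0 : ℝ) ×ˢ Set.univ) w q H < ⊤ →
      HasTypeITimeDecay C w →
      IsClassicalNSSolutionOn (Set.Iio 0) 1 0 w q →
      ∀ (l : ℝ) (R : ℝ³ ≃ₗᵢ[ℝ] ℝ³) (ξ : ℝ³), 1 < l →
        (fun z : ℝ × ℝ³ => l • R.symm (w (l ^ 2 * z.1) (l • R z.2 + ξ)))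
          =ᵐ[volume.restrict (Set.Iio (0 : ℝ) ×ˢ Set.univ)] (fun z : ℝ × ℝ³ => w z.1 z.2) →
        ∀ y : ℝ³, y ≠ l • R y + ξ → ¬ IsBackwardSingularPoint w ((0 : ℝ), y) := by
  sorry

/-- **stub 3b — `stub_decayOfSatelliteFree` — LANDED (p142689, wave 1 of lead c5):** now the tree theorem
`Theorems.SymmetryModuliCountForcedSymmetry.stub_decayOfSatelliteFree`.  A classical profile on `(−∞,0)` with the time rate
`‖w(t,x)‖ ≤ C/√(−t)`, RDSS about the origin a.e. on the slab, all of whose final-slice points `y ≠ 0` are regular, obeys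
`HasTypeIDecay C₀ w` for some `C₀` (Chae–Wolf's scaling step, no Navier–Stokes input).
[cite: ChaeWolf2017RemovingDSS, proof of Thm 1.1, estimate (1.5)] -/
theorem stub_decayOfSatelliteFree :
    ∀ (w : ℝ → ℝ³ → ℝ³) (q : ℝ → ℝ³ → ℝ) (C : ℝ),
      HasTypeITimeDecay C w →
      IsClassicalNSSolutionOn (Set.Iio 0) 1 0 w q →
      ∀ (l : ℝ) (R : ℝ³ ≃ₗᵢ[ℝ] ℝ³), 1 < l →
        (fun z : ℝ × ℝ³ => l • R.symm (w (l ^ 2 * z.1) (l • R z.2)))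
          =ᵐ[volume.restrict (Set.Iio (0 : ℝ) ×ˢ Set.univ)] (fun z : ℝ × ℝ³ => w z.1 z.2) →
        (∀ y : ℝ³, y ≠ l • R y → ¬ IsBackwardSingularPoint w ((0 : ℝ), y)) →
        ∃ C₀ : ℝ, HasTypeIDecay C₀ w :=
  Summit.NavierStokesRegularity.NavierStokesRegularity.Theorems.SymmetryModuliCountForcedSymmetry.stub_decayOfSatelliteFree

/-- **stub 3c — `stub_centredWall` (OPEN PROBLEM, named: Bradshaw–Tsai 2017 OP 5.1, Tsai 2018 Conj. 8.8–8.9,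
Pineau–Vicol 2026 Conj. 1.1, in the class `𝒦_C ∩ C^∞`; registered stub of crux stmt-8561's line `birth`, verbatim).**
A smooth profile `(w, q, H)` of `𝒦_C`, RDSS about the ORIGIN a.e. on the slab (`(t,x) ↦ l • R⁻¹ w (l²t) (l R x)`,
`l > 1`, any `R ∈ O(3)`), WITH space–time Type-I decay `HasTypeIDecay C₀ w`, is regular at the origin (equivalently,
vanishes: a centre-regular RDSS profile is zero by iterating the similarity).  Implied by the canonical
`Summit.NavierStokesRegularity.NavierStokesRegularity.TypeIDSSLiouvilleConjecture` via the known-type class bridge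
(`exists_isTypeIAncientMild_repr_of_slabProfile` + pointwise invariance + truncation at `t ≥ 0`).  Proved rungs: SS;
`1 < λ < λ_*(C₀)` (Chae–Wolf 2017 Thm 1.3, Pineau–Vicol Thms 1.6–1.7, tree `rdssCompact_pineauVicol_thm17_small`); RSS
at extreme `α` (Pineau–Vicol Thm 1.4, tree `pineauVicol2026_rss_liouville_holds`).  Why it might fail: one decaying
backward Type-I (R)DSS profile. [cite: BradshawTsai2017CPDE, OP 5.1; Tsai2018, Conj. 8.8–8.9; PineauVicol2026, Conj. 1.1] -/
theorem stub_centredWall :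
    ∀ (w : ℝ → ℝ³ → ℝ³) (q : ℝ → ℝ³ → ℝ) (H : ℝ → ℝ³ → ℝ³ →L[ℝ] ℝ³) (C : ℝ),
      IsSuitableWeakSolutionOn (slab ℝ³ (Set.Iio 0) isOpen_Iio) 1 0 w q →
      HasWeakSpatialGradientOn (slab ℝ³ (Set.Iio 0) isOpen_Iio) w H →
      typeIBound (Set.Iio (0 : ℝ) ×ˢ Set.univ) w q H < ⊤ →
      HasTypeITimeDecay C w →
      IsClassicalNSSolutionOn (Set.Iio 0) 1 0 w q →
      ∀ (l : ℝ) (R : ℝ³ ≃ₗᵢ[ℝ] ℝ³), 1 < l →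
        (fun z : ℝ × ℝ³ => l • R.symm (w (l ^ 2 * z.1) (l • R z.2)))
          =ᵐ[volume.restrict (Set.Iio (0 : ℝ) ×ˢ Set.univ)] (fun z : ℝ × ℝ³ => w z.1 z.2) →
        (∃ C₀ : ℝ, HasTypeIDecay C₀ w) →
        ¬ IsBackwardSingularPoint w 0 := by
  sorry

/-- **Birth composition, re-keyed (kernel-checked, no sorry of its own; = `RDSSLiouvilleInClass_of` of
`Cruxes/RDSSLiouvilleInClass/Lines/birth.lean` with the stubs entering BY NAME).**  Reduce to `τ = 0` by the landed
`rdssLiouvilleInClass_iff_centreTimeZero` (p138494); if `ξ ≠ 0` the origin is a non-centre point of the final slice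
(`0 ≠ l R 0 + ξ`), regular by stub 3a; if `ξ = 0`, stub 3a clears every `y ≠ l R y`, stub 3b gives space–time decay,
stub 3c removes the centre. [cite: AlbrittonBarker2019, §1; ChaeWolf2017RemovingDSS, Thm 1.1] -/
theorem rdssLiouvilleInClass_of_birth :
    Summit.NavierStokesRegularity.NavierStokesRegularity.Theses.DulacContraction.RDSSLiouvilleInClass := by
  rw [Summit.NavierStokesRegularity.NavierStokesRegularity.Theorems.SymmetryModuliCountForcedSymmetry.rdssLiouvilleInClass_iff_centreTimeZero]
  intro w q H C hsw hwg hI hdec hcl hinv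
  obtain ⟨l, hl, R, ξ, hae⟩ := hinv
  by_cases hξ : ξ = 0
  · -- centre AT the origin: satellites (3a), decay (3b), wall (3c)
    subst hξ
    have hae0 : (fun z : ℝ × ℝ³ => l • R.symm (w (l ^ 2 * z.1) (l • R z.2)))
        =ᵐ[volume.restrict (Set.Iio (0 : ℝ) ×ˢ Set.univ)] (fun z : ℝ × ℝ³ => w z.1 z.2) := by
      simpa only [add_zero] using hae
    have hoff : ∀ y : ℝ³, y ≠ l • R y → ¬ IsBackwardSingularPoint w ((0 : ℝ), y) := by
      intro y hy
      exact stub_satelliteExclusion w q H C hsw hwg hI hdec hcl l R 0 hl hae y (by simpa only [add_zero] using hy)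
    obtain ⟨C₀, hC₀⟩ := stub_decayOfSatelliteFree w q C hdec hcl l R hl hae0 hoff
    exact stub_centredWall w q H C hsw hwg hI hdec hcl l R hl hae0 ⟨C₀, hC₀⟩
  · -- centre `x* ≠ 0` on the final slice: the origin is a satellite point, regular by stub 3a
    have h0 : (0 : ℝ³) ≠ l • R 0 + ξ := by
      intro h
      apply hξ
      have hz : l • R (0 : ℝ³) + ξ = ξ := by simp
      rw [hz] at h
      exact h.symm
    exact stub_satelliteExclusion w q H C hsw hwg hI hdec hcl l R ξ hl hae 0 h0

/-- **Stub 3 — RDSS LIOUVILLE IN THE LOCAL TYPE-I CLASS** = item stmt-NavierStokesRegularity-8561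
(`DulacContraction.RDSSLiouvilleInClass`) BY NAME — since gen 5 a THEOREM of this skeleton: the birth composition of the
three registered stubs 3a–3c (`rdssLiouvilleInClass_of_birth`).  Contains Tsai's backward λ-DSS conjecture and
Perelman's RSS conjecture (stub 3c) and the satellite lemma (stub 3a).  Shared statement: a proof here closes 8561 too.
[cite: BradshawTsai2017CPDE, OP 5.1; Tsai2018, Conj. 8.8–8.9; ChaeWolf2017RemovingDSS; PineauVicol2026] -/
theorem stub_rdssLiouville :
    Summit.NavierStokesRegularity.NavierStokesRegularity.Theses.DulacContraction.RDSSLiouvilleInClass :=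
  rdssLiouvilleInClass_of_birth

/-! ## Composition: the registered stubs prove the crux BY NAME -/

/-- The route target `X` from the three registered stubs (used by name, skeleton-register form): a nonzero `u ∈ A_C` gives a
singular slab profile (`stub_slabProfileOfNonzero`), hence a uniformly recurrent singular one (`recurrentReduction_proof`,
stmt-1590, LANDED), hence an RDSS singular smooth one (`stub_recurrentClosing`), which `stub_rdssLiouville` (= stmt-8561) declares
regular at the origin — contradiction.  The same composition with the three statements as HYPOTHESES (sorry-free, for
`route edit --split … --glue-by`) is on file as `SymmetryModuliCountForcedSymmetryRecurrentClosingSplit.lean` (evidence on the item). -/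
theorem typeIAncientLiouville_of_line :
    Summit.NavierStokesRegularity.NavierStokesRegularity.Theses.SymmetryModuliCount.TypeIAncientLiouville := by
  intro C u hu t ht x
  by_contra hx
  have hu' : Literature.Analysis.FluidPDE.IsTypeIAncientMild C u :=
    Literature.Analysis.FluidPDE.isTypeIAncientMild_iff.2 hu
  obtain ⟨w, q, G, C', hw, hG, hI, hC', hsing⟩ := stub_slabProfileOfNonzero C u hu' ⟨t, ht, x, hx⟩
  obtain ⟨w₁, q₁, H₁, hw₁, hG₁, hI₁, hC₁, hsing₁, hrec₁⟩ :=
    Summit.NavierStokesRegularity.NavierStokesRegularity.Theorems.recurrentReduction_proof w q G C' hw hG hI hC' hsing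
  obtain ⟨w₂, q₂, H₂, C₂, hw₂, hG₂, hI₂, hC₂, hcl₂, hrdss₂, hsing₂⟩ :=
    stub_recurrentClosing w₁ q₁ H₁ C' hw₁ hG₁ hI₁ hC₁ hrec₁ hsing₁
  exact stub_rdssLiouville w₂ q₂ H₂ C₂ hw₂ hG₂ hI₂ hC₂ hcl₂ hrdss₂ hsing₂

/-- **The line concludes the crux BY NAME.**  `ForcedSymmetry` from the three registered stubs, via the route target
`X` (`typeIAncientLiouville_of_line`) and the landed collapse direction `forcedSymmetry_of_typeIAncientLiouville`
(the zero field carries every similarity symmetry).  No hypothesis: the stubs enter by name. -/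
theorem ForcedSymmetry_of :
    Summit.NavierStokesRegularity.NavierStokesRegularity.Theses.SymmetryModuliCount.ForcedSymmetry :=
  Summit.NavierStokesRegularity.NavierStokesRegularity.Theorems.forcedSymmetry_of_typeIAncientLiouville
    typeIAncientLiouville_of_line

end Summit.NavierStokesRegularity.NavierStokesRegularity.Cruxes.ForcedSymmetry.RecurrentClosing

end
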